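import Summits.CriticalPhenomena.CardyFormulaZ2.Theorems.CardyUSTContinuationUniformAnalyticExtensionStubZeroFreeCrossing
import Literature.Probability.Percolation.BoxCrossingProofs
import Mathlib.Data.Nat.Choose.Sum
import HarnessLib

/-!
# Towards the stub `stub_zeroFreeJoint` of the line `registered` for the crux
# `UniformAnalyticExtension` (stmt-CriticalPhenomena-6047, route `CardyUSTContinuation`)

The stub (= the birth stub `stub_zeroFree`) asks, for every conformal rectangle `R` and
`t₁ ∈ (0,1)`, for a `δ`-UNIFORM `ρ > 0` such that for all small meshes `δ > 0` the jointly-wired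
self-dual FK partition polynomial `Z_δ = fkTwoArcPartitionPolynomials R δ .joint ∈ ℕ[X]`
(`Z_δ(t) = Σ_{ω ⊆ E(Ω_δ)} t^{|ω| + 2k(ω)}`) has no zero in the complex `ρ`-neighbourhood of
`[t₁, 1]`.  The `δ`-uniform part is a Lee–Yang statement at criticality (open in print).  This
file (lead c5) settles the PER-MESH content and proves the TIGHTNESS of the stub at `t = −1`:

* `zeroFreeJoint_pointwise`: the stub with the quantifiers `∃ ρ` and `∀ᶠ δ` SWAPPED (for every
  `δ > 0`, `Z_δ ≠ 0` has finitely many roots, none on `(0,∞)`);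
* `zeroFreeJoint_aeval_neg_one_rcArcPolynomial`: `Z^w_G(−1) = 0` for EVERY finite graph with an
  edge and every wiring — the parity involution `Σ_{ω ⊆ E} (−1)^{|ω| + 2k(ω)} = Σ_{ω ⊆ E} (−1)^{|ω|}
  = 0`;
* `zeroFreeJoint_eventually_adj`: for all small `δ > 0` the discrete domain `Ω_δ` of a conformal
  rectangle has an edge (its two discrete arcs are disjoint and joined by a path);
* `zeroFreeJoint_eventually_aeval_neg_one`: hence `Z_δ(−1) = 0` for all small `δ > 0`, for
  every conformal rectangle and both wirings: `t = −1` is a zero of every `Z_δ`, matching the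
  pole of the continuum Miller–Werner function `U(t, η)` at `t = −1` for every modulus `η`;
* `zeroFreeJoint_rho_le`: consequently every witness `ρ` of `stub_zeroFreeJoint` at `(R, t₁)`,
  `t₁ > 0`, satisfies `ρ ≤ 1 + t₁` — the stub cannot hold with a neighbourhood reaching `t = −1`.

What remains of the stub is exactly the uniformity of `ρ` in `δ` inside the disc of radius
`1 + t₁`.
-/

noncomputable section

open Filter Topology Set Polynomial Metric
open Literature.Probability.LatticeModels
open Literature.Probability.RandomPlanarGeometry (ConformalRectangle)

namespace Summit.CriticalPhenomena.CardyFormulaZ2.Cruxes.UniformAnalyticExtension.Birth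

/-- **The stub with swapped quantifiers (per-mesh zero-freeness of `Z_δ`).** For every conformal
rectangle `R` and `t₁ ∈ (0,1)`, for every `δ > 0` there is `ρ > 0` (depending on `δ`) such that
`Z_δ(z) ≠ 0` on the complex `ρ`-neighbourhood of `[t₁, 1]` (`Z_δ ≠ 0` in `ℕ[X]`: finitely many
roots, none on the positive axis).  The registered stub `stub_zeroFreeJoint` is this statement
with `ρ` uniform in `δ`. [folklore] -/
theorem zeroFreeJoint_pointwise :
    ∀ R : ConformalRectangle, ∀ t₁ ∈ Set.Ioo (0:ℝ) 1, ∀ᶠ δ in 𝓝[>] (0:ℝ), ∃ ρ > (0:ℝ),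
      ∀ z ∈ thickening ρ (((↑) : ℝ → ℂ) '' Set.Icc t₁ 1),
        aeval z (fkTwoArcPartitionPolynomials R δ ArcWiring.joint) ≠ 0 := by
  intro R t₁ ht₁
  filter_upwards [self_mem_nhdsWithin] with δ hδ
  exact zeroFreeCrossing_exists_thickening_of_ne_zero _
    (fkTwoArcPartitionPolynomials_ne_zero R hδ _) ht₁.1

/-- **Parity involution: `Z^w_G(−1) = 0`.** For every finite graph `G` with at least one edge,
every pair of wired sets and every wiring, the self-dual generating polynomial vanishes at
`t = −1`: `Σ_{ω ⊆ E(G)} (−1)^{|ω| + 2k^w(ω)} = Σ_{ω ⊆ E(G)} (−1)^{|ω|} = 0` (toggle one fixed edge).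
[folklore] -/
theorem zeroFreeJoint_aeval_neg_one_rcArcPolynomial {V : Type*} [Fintype V] [DecidableEq V]
    (G : SimpleGraph V) [DecidableRel G.Adj] (hE : G.edgeFinset.Nonempty) (B₁ B₂ : Set V)
    (w : ArcWiring) : aeval (-1 : ℂ) (rcArcPolynomial G B₁ B₂ w) = 0 := by
  rw [aeval_rcArcPolynomial]
  have h : ∀ ω ∈ G.edgeFinset.powerset,
      (-1 : ℂ) ^ (Finset.card ω + 2 * arcClusterCount (↑ω : Literature.Probability.Percolation.BondConfig V) B₁ B₂ w) =
        (((-1 : ℤ) ^ Finset.card ω : ℤ) : ℂ) := by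
    intro ω _
    rw [pow_add, pow_mul, neg_one_sq, one_pow, mul_one]
    push_cast
    rfl
  rw [Finset.sum_congr rfl h, ← Int.cast_sum, Finset.sum_powerset_neg_one_pow_card_of_nonempty hE,
    Int.cast_zero]

/-- **`Ω_δ` eventually has an edge.** For every conformal rectangle, for all small `δ > 0` the
discrete domain graph `discreteDomainGraph R.carrier δ` has an adjacent pair: the discrete arcs of
`(ab)` and `(cd)` are disjoint (`eventually_discreteArc_inter_eq_empty`) and joined by a path of
`Ω_δ` (`zeroFreeCrossing_eventually_reachable`), which therefore has an edge. [folklore] -/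
theorem zeroFreeJoint_eventually_adj (R : ConformalRectangle) :
    ∀ᶠ δ in 𝓝[>] (0:ℝ), ∃ x y : Site 2, (discreteDomainGraph R.carrier δ).Adj x y := by
  obtain ⟨δ₀, hδ₀, hdisj⟩ := Literature.Probability.Percolation.eventually_discreteArc_inter_eq_empty R
  filter_upwards [zeroFreeCrossing_eventually_reachable R, Ioo_mem_nhdsGT hδ₀] with δ hreach hδ
  obtain ⟨a, ha, z, hz, haz⟩ := hreach
  have hne : a ≠ z := by
    rintro rfl
    have : a ∈ discreteArc R.carrier δ (R.arc 0) ∩ discreteArc R.carrier δ (R.arc 2) := ⟨ha, hz⟩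
    rw [hdisj δ hδ.1 hδ.2] at this
    exact this
  obtain ⟨p⟩ := haz
  cases p with
  | nil => exact absurd rfl hne
  | cons hadj _ => exact ⟨_, _, hadj⟩

/-- **`Z_δ(−1) = 0` for all small meshes.** For every conformal rectangle `R` and wiring `w`,
for all small `δ > 0` the two-arc partition polynomial of `Ω_δ` vanishes at `t = −1`.  (The
continuum counterpart: the Miller–Werner joint-wiring function `U(t, η)` has a pole at `t = −1`
for every `η`.) [folklore] -/
theorem zeroFreeJoint_eventually_aeval_neg_one (R : ConformalRectangle) (w : ArcWiring) :
    ∀ᶠ δ in 𝓝[>] (0:ℝ), aeval (-1 : ℂ) (fkTwoArcPartitionPolynomials R δ w) = 0 := by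
  classical
  filter_upwards [zeroFreeJoint_eventually_adj R, self_mem_nhdsWithin] with δ hadj hδ
  obtain ⟨x, y, hxy⟩ := hadj
  have hδ' : (0:ℝ) < δ := hδ
  letI : Fintype (meshDomain R.carrier δ) := (meshDomain_finite R.isBounded hδ').fintype
  rw [fkTwoArcPartitionPolynomials_of_pos R hδ']
  obtain ⟨-, hx, hy⟩ := discreteDomainGraph_adj_iff.1 hxy
  refine zeroFreeJoint_aeval_neg_one_rcArcPolynomial _ ⟨s(⟨x, hx⟩, ⟨y, hy⟩), ?_⟩ _ _ _
  rw [SimpleGraph.mem_edgeFinset, SimpleGraph.mem_edgeSet, domainSubgraph, SimpleGraph.comap_adj]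
  exact hxy

/-- **Tightness of `stub_zeroFreeJoint` at `t = −1`.** If, for a conformal rectangle `R` and
`0 < t₁ ≤ 1`, the polynomials `Z_δ` are zero-free on the complex `ρ`-neighbourhood of `[t₁, 1]`
for all small `δ > 0` (the conclusion of the stub with witness `ρ`), then `ρ ≤ 1 + t₁`: otherwise
the neighbourhood contains `t = −1`, a zero of every `Z_δ`. [folklore] -/
theorem zeroFreeJoint_rho_le (R : ConformalRectangle) {t₁ ρ : ℝ} (ht₀ : 0 < t₁) (ht₁ : t₁ ≤ 1)
    (h : ∀ᶠ δ in 𝓝[>] (0:ℝ), ∀ z ∈ thickening ρ (((↑) : ℝ → ℂ) '' Set.Icc t₁ 1),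
      aeval z (fkTwoArcPartitionPolynomials R δ ArcWiring.joint) ≠ 0) :
    ρ ≤ 1 + t₁ := by
  refine le_of_not_gt fun hlt => ?_
  have hmem : (-1 : ℂ) ∈ thickening ρ (((↑) : ℝ → ℂ) '' Set.Icc t₁ 1) := by
    refine mem_thickening_iff.2 ⟨t₁, ⟨t₁, ⟨le_rfl, ht₁⟩, rfl⟩, ?_⟩
    rw [Complex.dist_eq, show (-1 : ℂ) - (t₁ : ℂ) = -((1 + t₁ : ℝ) : ℂ) by push_cast; ring, norm_neg,
      Complex.norm_real, Real.norm_eq_abs, abs_of_pos (by linarith)]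
    exact hlt
  obtain ⟨δ, hδz, hδ0⟩ := (h.and (zeroFreeJoint_eventually_aeval_neg_one R ArcWiring.joint)).exists
  exact hδz _ hmem hδ0

/-- **Corollary (the shape of any proof of the stub).** Every witness `ρ` of `stub_zeroFreeJoint`
at `(R, t₁)` with `t₁ ∈ (0,1)` lies in `(0, 1 + t₁]`: the `δ`-uniform zero-free neighbourhood,
if it exists, stays inside the disc through `t = −1`. [folklore] -/
theorem zeroFreeJoint_witness_mem_Ioc (R : ConformalRectangle) {t₁ : ℝ} (ht₁ : t₁ ∈ Set.Ioo (0:ℝ) 1)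
    {ρ : ℝ} (hρ : 0 < ρ)
    (h : ∀ᶠ δ in 𝓝[>] (0:ℝ), ∀ z ∈ thickening ρ (((↑) : ℝ → ℂ) '' Set.Icc t₁ 1),
      aeval z (fkTwoArcPartitionPolynomials R δ ArcWiring.joint) ≠ 0) :
    ρ ∈ Set.Ioc (0:ℝ) (1 + t₁) :=
  ⟨hρ, zeroFreeJoint_rho_le R ht₁.1 ht₁.2.le h⟩

end Summit.CriticalPhenomena.CardyFormulaZ2.Cruxes.UniformAnalyticExtension.Birth
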